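/-
Copyright: internal research formalization. Source texts: G. Kempf, F. Knudsen, D. Mumford,
B. Saint-Donat, Toroidal Embeddings I (LNM 339, Springer 1973) [KempfEtAl1973], Ch. II §1 Def. 5
and §2 (Theorems 4*, 9*, 11* for conical polyhedral complexes); W. Fulton, Introduction to Toric
Varieties [Fulton1993Toric], §1.4 p. 20–21 (fans corresponding under a lattice isomorphism).
-/
import Mathlib
import HarnessLib
import Literature.Geometry.PolyhedralFans.LinkTransport
import Literature.Geometry.PolyhedralFans.MultiStarSubdivision
import Literature.Geometry.PolyhedralFans.LinkedRefinementFamily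

/-!
# Linked regular refinement: from a family of fans back to one fan (coordinate renaming)

Topic: `Literature/Geometry/PolyhedralFans`. `LinkedRefinement` states [KempfEtAl1973] Ch. II §2
Thm. 11* in two forms, `Fan.LinkedRegularRefinement` (ONE rational fan `Δ₀ ⊆ ℚ^κ` with links) and
`Fan.LinkedRegularRefinementFamily` (a family `Δ₀ i ⊆ ℚ^{n i}` with links between members). This
file proves that the family form implies the one-fan form:

  `Fan.linkedRegularRefinement_of_linkedRegularRefinementFamily :
      Fan.LinkedRegularRefinementFamily → Fan.LinkedRegularRefinement`,

so that a proof of the family statement discharges BOTH named statements; with the block-sum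
reduction of `LinkedRefinementFamily` the two named statements are EQUIVALENT
(`Fan.linkedRegularRefinementFamily_iff`). The argument is pure
transport ([Fulton1993Toric] §1.4 p. 21: a lattice isomorphism carries fans to fans and all
lattice notions along): rename the coordinates `κ ≃ Fin N` (`reindexLin`, a lattice-preserving
linear equivalence, self-adjoint for the dot product up to inversion), regard the renamed fan
as a family with ONE member and each link as a family link (`Fan.Link.toFamily`), apply the
family statement, and carry the refinement, the function `f`, the cone-wise tight strict
support data and the link compatibilities back along the inverse renaming (transport theorems
of `LinkTransport`: `Fan.mapOn_starIter_cones`, `Fan.IsRegular.mapOn`, …).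

All statements are PROVED; no named facts. New definitions: `reindexLin`, `Fan.reindex`,
`Fan.Link.toFamily` (bookkeeping of the transport only).

References: [KempfEtAl1973] Ch. II §1 Def. 5, §2 Thm. 11*; [Fulton1993Toric] §1.4 p. 20–21,
§2.6 p. 47–48.
-/

noncomputable section

namespace Literature.Geometry.PolyhedralFans

open PointedCone Finset Matrix

/-! ## Renaming coordinates: `ℚ^κ ≃ ℚ^{κ'}` along `s : κ' ≃ κ` -/

section Reindex

variable {κ κ' : Type*}

/-- **Coordinate renaming** along a bijection `s : κ' ≃ κ`: `x ↦ x ∘ s`, a linear equivalence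
`ℚ^κ → ℚ^{κ'}` (inverse: renaming along `s.symm`) preserving the lattices.
[cite: Fulton1993Toric, §1.4 p. 21] -/
def reindexLin (s : κ' ≃ κ) : (κ → ℚ) →ₗ[ℚ] (κ' → ℚ) where
  toFun x a := x (s a)
  map_add' _ _ := rfl
  map_smul' _ _ := rfl

/-- The renaming, coordinate-wise. [cite: Fulton1993Toric, §1.4 p. 21] -/
@[simp] theorem reindexLin_apply (s : κ' ≃ κ) (x : κ → ℚ) (a : κ') :
    reindexLin s x a = x (s a) := rfl

/-- Renaming along `s.symm` undoes renaming along `s`. [cite: Fulton1993Toric, §1.4 p. 21] -/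
@[simp] theorem reindexLin_symm_reindexLin (s : κ' ≃ κ) (x : κ → ℚ) :
    reindexLin s.symm (reindexLin s x) = x := by
  funext k
  simp only [reindexLin_apply, Equiv.apply_symm_apply]

/-- Renaming along `s` undoes renaming along `s.symm`. [cite: Fulton1993Toric, §1.4 p. 21] -/
@[simp] theorem reindexLin_reindexLin_symm (s : κ' ≃ κ) (y : κ' → ℚ) :
    reindexLin s (reindexLin s.symm y) = y := by
  funext a
  simp only [reindexLin_apply, Equiv.symm_apply_apply]

/-- `reindexLin s.symm ∘ reindexLin s = id`. [cite: Fulton1993Toric, §1.4 p. 21] -/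
theorem reindexLin_symm_comp (s : κ' ≃ κ) : reindexLin s.symm ∘ₗ reindexLin s = LinearMap.id := by
  ext x k
  simp

/-- The renaming is injective (kernel form on the whole space, as used by `LinkTransport`).
[cite: Fulton1993Toric, §1.4 p. 21] -/
theorem reindexLin_eq_zero (s : κ' ≃ κ) :
    ∀ x ∈ (⊤ : Submodule ℚ (κ → ℚ)), reindexLin s x = 0 → x = 0 := fun x _ h => by
  rw [← reindexLin_symm_reindexLin s x, h, map_zero]

/-- The renaming maps lattice points to lattice points. [cite: Fulton1993Toric, §1.4 p. 21] -/
theorem reindexLin_mem_latticeN (s : κ' ≃ κ) {x : κ → ℚ} (hx : x ∈ latticeN κ) :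
    reindexLin s x ∈ latticeN κ' := fun a => hx (s a)

/-- Lattice condition of `LinkTransport` for the renaming (forward). [cite: Fulton1993Toric, §1.4 p. 21] -/
theorem reindexLin_lat (s : κ' ≃ κ) : ∀ x ∈ (⊤ : Submodule ℚ (κ → ℚ)),
    x ∈ latticeN κ → reindexLin s x ∈ latticeN κ' :=
  fun _ _ hx => reindexLin_mem_latticeN s hx

/-- Lattice condition of `LinkTransport` for the renaming (backward). [cite: Fulton1993Toric, §1.4 p. 21] -/
theorem reindexLin_lat' (s : κ' ≃ κ) : ∀ y ∈ latticeN κ',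
    y ∈ (⊤ : Submodule ℚ (κ → ℚ)).map (reindexLin s) →
      ∃ x ∈ (⊤ : Submodule ℚ (κ → ℚ)), x ∈ latticeN κ ∧ reindexLin s x = y :=
  fun y hy _ => ⟨reindexLin s.symm y, Submodule.mem_top, reindexLin_mem_latticeN s.symm hy,
    reindexLin_reindexLin_symm s y⟩

/-- **The renaming is adjoint to the inverse renaming for the dot product**:
`⟨M, x ∘ s⟩ = ⟨M ∘ s⁻¹, x⟩`. [cite: Fulton1993Toric, §1.4 p. 21] -/
theorem dotProduct_reindexLin [Fintype κ] [Fintype κ'] (s : κ' ≃ κ) (M : κ' → ℚ) (x : κ → ℚ) :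
    M ⬝ᵥ reindexLin s x = reindexLin s.symm M ⬝ᵥ x := by
  simp only [dotProduct, reindexLin_apply]
  have h : ∀ a : κ', M a * x (s a) = (fun k : κ => M (s.symm k) * x k) (s a) := fun a => by
    simp only [Equiv.symm_apply_apply]
  simp_rw [h]
  exact Equiv.sum_comp s (fun k : κ => M (s.symm k) * x k)

/-- Renaming both cones does not change inclusion. [cite: Fulton1993Toric, §1.4 p. 21] -/
theorem map_reindexLin_le_iff (s : κ' ≃ κ) {ρ σ : PointedCone ℚ (κ → ℚ)} :
    ρ.map (reindexLin s) ≤ σ.map (reindexLin s) ↔ ρ ≤ σ :=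
  map_le_map_iff_of_subset (reindexLin_eq_zero s) (coe_subset_top ρ) (coe_subset_top σ)

/-- Membership of a renamed vector in a renamed cone. [cite: Fulton1993Toric, §1.4 p. 21] -/
theorem reindexLin_mem_map_iff (s : κ' ≃ κ) {ρ : PointedCone ℚ (κ → ℚ)} {x : κ → ℚ} :
    reindexLin s x ∈ ρ.map (reindexLin s) ↔ x ∈ ρ :=
  map_mem_map_iff_of_subset (reindexLin_eq_zero s) (coe_subset_top ρ) Submodule.mem_top

/-- Renaming a cone along `s` and back along `s.symm` gives the cone.
[cite: Fulton1993Toric, §1.4 p. 21] -/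
@[simp] theorem map_reindexLin_symm_map_reindexLin (s : κ' ≃ κ) (ρ : PointedCone ℚ (κ → ℚ)) :
    (ρ.map (reindexLin s)).map (reindexLin s.symm) = ρ := by
  rw [PointedCone.map_map, reindexLin_symm_comp, PointedCone.map_id]

namespace Fan

/-- **The renamed fan** `Δ ∘ s` (image under the coordinate renaming; a fan by `Fan.mapOn`).
[cite: Fulton1993Toric, §1.4 p. 21] -/
def reindex (s : κ' ≃ κ) (Δ : Fan ℚ (κ → ℚ)) : Fan ℚ (κ' → ℚ) :=
  Δ.mapOn (reindexLin s) (U := ⊤) (fun _ _ _ _ => Submodule.mem_top) (reindexLin_eq_zero s)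

/-- The cones of the renamed fan. [cite: Fulton1993Toric, §1.4 p. 21] -/
@[simp] theorem reindex_cones (s : κ' ≃ κ) (Δ : Fan ℚ (κ → ℚ)) :
    (Δ.reindex s).cones = (fun σ => σ.map (reindexLin s)) '' Δ.cones := rfl

/-- Renaming along `s` then along `s.symm` gives the fan back. [cite: Fulton1993Toric, §1.4 p. 21] -/
theorem reindex_reindex_symm (s : κ' ≃ κ) (Δ : Fan ℚ (κ → ℚ)) :
    (Δ.reindex s).reindex s.symm = Δ := by
  refine eq_of_cones_eq ?_
  ext ρ
  simp only [reindex_cones, Set.mem_image, exists_exists_and_eq_and,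
    map_reindexLin_symm_map_reindexLin, exists_eq_right]

/-- A cone of `ℚ^κ` is a cone of `Δ₁ ∘ s.symm` iff its renaming is a cone of `Δ₁`.
[cite: Fulton1993Toric, §1.4 p. 21] -/
theorem mem_reindex_symm_iff (s : κ' ≃ κ) {Δ₁ : Fan ℚ (κ' → ℚ)} {τ : PointedCone ℚ (κ → ℚ)} :
    τ ∈ (Δ₁.reindex s.symm).cones ↔ τ.map (reindexLin s) ∈ Δ₁.cones := by
  rw [reindex_cones, Set.mem_image]
  constructor
  · rintro ⟨T, hT, rfl⟩
    have h : (T.map (reindexLin s.symm)).map (reindexLin s) = T := by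
      have := map_reindexLin_symm_map_reindexLin s.symm T
      rwa [Equiv.symm_symm] at this
    rwa [h]
  · intro h
    exact ⟨τ.map (reindexLin s), h, map_reindexLin_symm_map_reindexLin s τ⟩

/-- The renamed fan of a rational fan is rational. [cite: KempfEtAl1973, Ch. II §2 Thm. 4*] -/
theorem IsRational.reindex (s : κ' ≃ κ) {Δ : Fan ℚ (κ → ℚ)} (h : Δ.IsRational) :
    (Δ.reindex s).IsRational :=
  h.mapOn (reindexLin_lat s)

/-- Regularity is transported along a renaming. [cite: KempfEtAl1973, Ch. II §2 Thm. 11*] -/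
theorem IsRegular.reindex [Fintype κ'] [DecidableEq κ'] (s : κ' ≃ κ) {Δ : Fan ℚ (κ → ℚ)}
    (h : Δ.IsRegular) : (Δ.reindex s).IsRegular :=
  h.mapOn (reindexLin_lat s) (reindexLin_lat' s)

/-- Simpliciality is transported along a renaming. [cite: KempfEtAl1973, Ch. II §2 Thm. 11*] -/
theorem IsSimplicial.reindex (s : κ' ≃ κ) {Δ : Fan ℚ (κ → ℚ)} (h : Δ.IsSimplicial) :
    (Δ.reindex s).IsSimplicial :=
  h.mapOn

/-- The support of the renamed fan. [cite: Fulton1993Toric, §1.4 p. 21] -/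
theorem reindex_support (s : κ' ≃ κ) (Δ : Fan ℚ (κ → ℚ)) :
    (Δ.reindex s).support = reindexLin s '' Δ.support :=
  mapOn_support

/-- **Iterated star subdivisions commute with renaming**: subdividing the renamed fan through `l`
is renaming the fan subdivided through `l ∘ s⁻¹`. [cite: KempfEtAl1973, Ch. II §2 Thm. 4*] -/
theorem reindex_starIter (s : κ' ≃ κ) (Δ : Fan ℚ (κ → ℚ)) (l : List (κ' → ℚ)) :
    (Δ.reindex s).starIter l = (Δ.starIter (l.map (reindexLin s.symm))).reindex s := by
  refine (eq_of_cones_eq ?_).symm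
  have h := mapOn_starIter_cones (E := reindexLin s) (U := ⊤) (hinj := reindexLin_eq_zero s)
    (l.map (reindexLin s.symm)) (fun _ _ => Submodule.mem_top) (Δ := Δ)
    (fun _ _ _ _ => Submodule.mem_top)
  rw [List.map_map] at h
  have hl : (⇑(reindexLin s) ∘ ⇑(reindexLin s.symm)) = id := by
    funext y
    exact reindexLin_reindexLin_symm s y
  rw [hl, List.map_id] at h
  exact h

/-! ### Reading the cone-wise data back along the renaming -/

/-- The cones of `Δ₁ ∘ s⁻¹` inside `σ` correspond to the cones of `Δ₁` inside the renamed `σ`.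
[cite: Fulton1993Toric, §1.4 p. 21] -/
theorem map_reindexLin_mem_restrict_iff (s : κ' ≃ κ) {Δ₁ : Fan ℚ (κ' → ℚ)}
    {σ τ : PointedCone ℚ (κ → ℚ)} :
    τ.map (reindexLin s) ∈ (Δ₁.restrict (σ.map (reindexLin s))).cones ↔
      τ ∈ ((Δ₁.reindex s.symm).restrict σ).cones := by
  rw [mem_restrict_iff, mem_restrict_iff, mem_reindex_symm_iff, map_reindexLin_le_iff]

/-- **The cone-wise conclusion of [KempfEtAl1973] I §2 Thm. 11 is carried back along the
renaming**: if the cones of `Δ₁` inside the renamed `σ` cover it and carry integral tight strict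
support data `M`, non-negative on it, with minimum function `f`, then the cones of `Δ₁ ∘ s⁻¹`
inside `σ` cover `σ` and carry the data `τ ↦ (M (τ ∘ s)) ∘ s⁻¹` with minimum function `f ∘ s`.
[cite: KempfEtAl1973, Ch. II §2 Thm. 11*] -/
theorem restrict_transfer_of_reindex [Fintype κ] [Fintype κ'] (s : κ' ≃ κ) {Δ₁ : Fan ℚ (κ' → ℚ)}
    {σ : PointedCone ℚ (κ → ℚ)} (f : (κ' → ℚ) → ℚ)
    (hsupp : (Δ₁.restrict (σ.map (reindexLin s))).support =
      (σ.map (reindexLin s) : Set (κ' → ℚ)))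
    {M : PointedCone ℚ (κ' → ℚ) → (κ' → ℚ)}
    (hM : (Δ₁.restrict (σ.map (reindexLin s))).IsStrictSupport M)
    (hMτ : ∀ T ∈ (Δ₁.restrict (σ.map (reindexLin s))).cones,
      M T ∈ latticeN κ' ∧ (∀ X ∈ σ.map (reindexLin s), 0 ≤ M T ⬝ᵥ X) ∧
        ∀ X ∈ T, M T ⬝ᵥ X = f X) :
    ((Δ₁.reindex s.symm).restrict σ).support = (σ : Set (κ → ℚ)) ∧
      ∃ m : PointedCone ℚ (κ → ℚ) → (κ → ℚ),
        ((Δ₁.reindex s.symm).restrict σ).IsStrictSupport m ∧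
        ∀ τ ∈ ((Δ₁.reindex s.symm).restrict σ).cones,
          m τ ∈ latticeN κ ∧ (∀ x ∈ σ, 0 ≤ m τ ⬝ᵥ x) ∧
            ∀ x ∈ τ, m τ ⬝ᵥ x = f (reindexLin s x) := by
  refine ⟨?_, fun τ => reindexLin s.symm (M (τ.map (reindexLin s))), ?_, fun τ hτ => ⟨?_, ?_, ?_⟩⟩
  · -- the cones of `Δ₁ ∘ s⁻¹` inside `σ` cover `σ`
    refine le_antisymm (restrict_support_subset σ) fun x hx => ?_
    have hX : reindexLin s x ∈ (Δ₁.restrict (σ.map (reindexLin s))).support := by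
      rw [hsupp]
      exact ⟨x, hx, rfl⟩
    obtain ⟨T, ⟨hT, hTσ⟩, hxT⟩ := mem_support.mp hX
    have hT' : (T.map (reindexLin s.symm)).map (reindexLin s) = T := by
      have := map_reindexLin_symm_map_reindexLin s.symm T
      rwa [Equiv.symm_symm] at this
    refine mem_support.mpr ⟨T.map (reindexLin s.symm), (map_reindexLin_mem_restrict_iff s).mp ?_, ?_⟩
    · rw [hT']
      exact ⟨hT, hTσ⟩
    · exact PointedCone.mem_map.mpr ⟨reindexLin s x, hxT, reindexLin_symm_reindexLin s x⟩
  · -- tight strict support data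
    intro ρ hρ ρ' hρ' u hu
    have hP := (map_reindexLin_mem_restrict_iff s).mpr hρ
    have hP' := (map_reindexLin_mem_restrict_iff s).mpr hρ'
    obtain ⟨h1, h2⟩ := hM hP hP' ((reindexLin_mem_map_iff s).mpr hu)
    rw [dotProduct_reindexLin, dotProduct_reindexLin] at h1 h2
    exact ⟨h1, fun h => (reindexLin_mem_map_iff s).mp (h2 h)⟩
  · -- integrality
    exact reindexLin_mem_latticeN s.symm (hMτ _ ((map_reindexLin_mem_restrict_iff s).mpr hτ)).1
  · -- non-negativity on `σ`
    intro x hx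
    rw [← dotProduct_reindexLin]
    exact (hMτ _ ((map_reindexLin_mem_restrict_iff s).mpr hτ)).2.1 _ ⟨x, hx, rfl⟩
  · -- the minimum function
    intro x hx
    rw [← dotProduct_reindexLin]
    exact (hMτ _ ((map_reindexLin_mem_restrict_iff s).mpr hτ)).2.2 _ ⟨x, hx, rfl⟩

/-! ### Links as family links of the one-member family -/

/-- **A link of `Δ₀` as a family link of the one-member family** `fun _ : Unit ↦ Δ₀ ∘ s`
(source, target and maps renamed). [cite: KempfEtAl1973, Ch. II §1 Def. 5] -/
def Link.toFamily {N : ℕ} (s : Fin N ≃ κ) {Δ₀ : Fan ℚ (κ → ℚ)} (ℓ : Δ₀.Link) :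
    Fan.FamilyLink (fun _ : Unit => N) (fun _ => Δ₀.reindex s) where
  i := ()
  j := ()
  src := ℓ.src.map (reindexLin s)
  tgt := ℓ.tgt.map (reindexLin s)
  src_mem := ⟨ℓ.src, ℓ.src_mem, rfl⟩
  tgt_mem := ⟨ℓ.tgt, ℓ.tgt_mem, rfl⟩
  toLin := reindexLin s ∘ₗ ℓ.toLin ∘ₗ reindexLin s.symm
  invLin := reindexLin s ∘ₗ ℓ.invLin ∘ₗ reindexLin s.symm
  mapsTo := by
    intro y hy
    obtain ⟨x, hx, rfl⟩ := PointedCone.mem_map.mp hy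
    refine PointedCone.mem_map.mpr ⟨ℓ.toLin x, ℓ.mapsTo x hx, ?_⟩
    simp only [LinearMap.coe_comp, Function.comp_apply, reindexLin_symm_reindexLin]
  mapsTo_inv := by
    intro y hy
    obtain ⟨x, hx, rfl⟩ := PointedCone.mem_map.mp hy
    refine PointedCone.mem_map.mpr ⟨ℓ.invLin x, ℓ.mapsTo_inv x hx, ?_⟩
    simp only [LinearMap.coe_comp, Function.comp_apply, reindexLin_symm_reindexLin]
  left_inv := by
    intro y hy
    obtain ⟨x, hx, rfl⟩ := PointedCone.mem_map.mp hy
    simp only [LinearMap.coe_comp, Function.comp_apply, reindexLin_symm_reindexLin, ℓ.left_inv x hx]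
  right_inv := by
    intro y hy
    obtain ⟨x, hx, rfl⟩ := PointedCone.mem_map.mp hy
    simp only [LinearMap.coe_comp, Function.comp_apply, reindexLin_symm_reindexLin,
      ℓ.right_inv x hx]
  integral := by
    intro y hy hN
    obtain ⟨x, hx, rfl⟩ := PointedCone.mem_map.mp hy
    simp only [LinearMap.coe_comp, Function.comp_apply, reindexLin_symm_reindexLin]
    refine reindexLin_mem_latticeN s (ℓ.integral x hx ?_)
    have h := reindexLin_mem_latticeN s.symm hN
    rwa [reindexLin_symm_reindexLin] at h
  integral_inv := by
    intro y hy hN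
    obtain ⟨x, hx, rfl⟩ := PointedCone.mem_map.mp hy
    simp only [LinearMap.coe_comp, Function.comp_apply, reindexLin_symm_reindexLin]
    refine reindexLin_mem_latticeN s (ℓ.integral_inv x hx ?_)
    have h := reindexLin_mem_latticeN s.symm hN
    rwa [reindexLin_symm_reindexLin] at h

/-- The family link of the inverse link is the inverse family link.
[cite: KempfEtAl1973, Ch. II §1 Def. 5] -/
theorem Link.toFamily_symm {N : ℕ} (s : Fin N ≃ κ) {Δ₀ : Fan ℚ (κ → ℚ)} (ℓ : Δ₀.Link) :
    Link.toFamily s ℓ.symm = (Link.toFamily s ℓ).symm := rfl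

/-- The family-link map on a renamed cone: it is the renaming of the image cone.
[cite: KempfEtAl1973, Ch. II §1 Def. 5] -/
theorem Link.map_toFamily_toLin {N : ℕ} (s : Fin N ≃ κ) {Δ₀ : Fan ℚ (κ → ℚ)} (ℓ : Δ₀.Link)
    (ρ : PointedCone ℚ (κ → ℚ)) :
    (ρ.map (reindexLin s)).map (Link.toFamily s ℓ).toLin =
      (ρ.map ℓ.toLin).map (reindexLin s) := by
  show (ρ.map (reindexLin s)).map (reindexLin s ∘ₗ ℓ.toLin ∘ₗ reindexLin s.symm) = _
  rw [PointedCone.map_map, PointedCone.map_map, LinearMap.comp_assoc, LinearMap.comp_assoc,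
    reindexLin_symm_comp, LinearMap.comp_id]

/-- **Link compatibility is carried back along the renaming**: compatibility of the one-member
family `fun _ ↦ Δ₁` with the family link of `ℓ` gives compatibility of `Δ₁ ∘ s⁻¹` with `ℓ`.
[cite: KempfEtAl1973, Ch. II §2 Thm. 11*] -/
theorem linkCompatible_of_toFamily {N : ℕ} (s : Fin N ≃ κ) {Δ₀ : Fan ℚ (κ → ℚ)} (ℓ : Δ₀.Link)
    {Δ₁ : Fan ℚ (Fin N → ℚ)}
    (h : Fan.FamilyLinkCompatible (fun _ : Unit => Δ₁) (Link.toFamily s ℓ)) :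
    Fan.LinkCompatible (Δ₁.reindex s.symm) ℓ := by
  intro ρ hρ
  have h1 : ρ.map (reindexLin s) ∈ (Δ₁.restrict (Link.toFamily s ℓ).src).cones :=
    (map_reindexLin_mem_restrict_iff s).mpr hρ
  have h2 := h _ h1
  rw [Link.map_toFamily_toLin] at h2
  exact (map_reindexLin_mem_restrict_iff s).mp h2

end Fan

end Reindex

/-! ## The reduction -/

/-- **[KempfEtAl1973] Ch. II §2 Thm. 11* for one fan with links follows from the family form**:
rename the coordinates `κ ≃ Fin |κ|`, view the renamed fan as a one-member family and each link as
a family link, apply `Fan.LinkedRegularRefinementFamily`, and carry everything back along the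
inverse renaming (`Fan.reindex_starIter`, `Fan.restrict_transfer_of_reindex`,
`Fan.linkCompatible_of_toFamily`). Together with the converse reduction (block sums, file
`LinkedRefinementFamily`) the two named statements of `LinkedRefinement` are equivalent.
[cite: KempfEtAl1973, Ch. II §2 Thm. 11*] -/
theorem Fan.linkedRegularRefinement_of_linkedRegularRefinementFamily
    (H : Fan.LinkedRegularRefinementFamily) : Fan.LinkedRegularRefinement := by
  intro κ _ _ Δ₀ hrat L
  -- rename the coordinates and view `Δ₀` as a one-member family
  set s : Fin (Fintype.card κ) ≃ κ := (Fintype.equivFin κ).symm with hs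
  obtain ⟨l, f, hmem, hL⟩ := H Unit (fun _ => Fintype.card κ) (fun _ => Δ₀.reindex s)
    (fun _ => hrat.reindex s) (Fan.Link.toFamily s '' L)
  obtain ⟨hl, -, hreg, hsimp, hf0, hσ⟩ := hmem ()
  -- the refinement of `Δ₀` and its description as the renamed refined member
  set l' : List (κ → ℚ) := (l ()).map (reindexLin s.symm) with hl'def
  have hfan : Δ₀.starIter l' = ((Δ₀.reindex s).starIter (l ())).reindex s.symm := by
    rw [Fan.reindex_starIter, Fan.reindex_reindex_symm]
  have hl' : ∀ w ∈ l', w ∈ latticeN κ ∧ w ≠ 0 := by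
    intro w hw
    rw [hl'def, List.mem_map] at hw
    obtain ⟨v, hv, rfl⟩ := hw
    obtain ⟨hvN, hv0⟩ := hl v hv
    refine ⟨reindexLin_mem_latticeN s.symm hvN, fun h => hv0 ?_⟩
    rw [← reindexLin_reindexLin_symm s v, h, map_zero]
  refine ⟨l', hl', ?_, ?_, ?_, fun x => f () (reindexLin s x), fun x => hf0 _, fun σ hσ₀ => ?_,
    fun ℓ hℓ => ?_⟩
  · -- refinement
    exact ⟨fun ρ hρ => Fan.starIter_exists_le _ hρ,
      Fan.starIter_support_eq _ fun w hw => (hl' w hw).2⟩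
  · -- regularity
    rw [hfan]
    exact hreg.reindex s.symm
  · -- simpliciality
    rw [hfan]
    exact hsimp.reindex s.symm
  · -- the cone-wise tight strict support data
    rw [hfan]
    obtain ⟨hsupp, M, hM, hMτ⟩ := hσ (σ := σ.map (reindexLin s)) ⟨σ, hσ₀, rfl⟩
    exact Fan.restrict_transfer_of_reindex s (f ()) hsupp hM hMτ
  · -- the links
    rw [hfan]
    obtain ⟨hc, hc', hf⟩ := hL (Fan.Link.toFamily s ℓ) ⟨ℓ, hℓ, rfl⟩
    refine ⟨Fan.linkCompatible_of_toFamily s ℓ hc, Fan.linkCompatible_of_toFamily s ℓ.symm ?_,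
      fun x hx => ?_⟩
    · rw [Fan.Link.toFamily_symm]
      exact hc'
    · have h := hf (reindexLin s x) ⟨x, hx, rfl⟩
      simp only [Fan.Link.toFamily, LinearMap.coe_comp, Function.comp_apply,
        reindexLin_symm_reindexLin] at h
      exact h

/-- **The two chart presentations of [KempfEtAl1973] Ch. II §2 Thm. 11* are equivalent**: the
family form (members in their own coordinate spaces) and the one-space form (block sums,
`Fan.linkedRegularRefinementFamily_of_linkedRegularRefinement`; renaming,
`Fan.linkedRegularRefinement_of_linkedRegularRefinementFamily`).
[cite: KempfEtAl1973, Ch. II §2 Thm. 11*] -/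
theorem Fan.linkedRegularRefinementFamily_iff :
    Fan.LinkedRegularRefinementFamily ↔ Fan.LinkedRegularRefinement :=
  ⟨Fan.linkedRegularRefinement_of_linkedRegularRefinementFamily,
    Fan.linkedRegularRefinementFamily_of_linkedRegularRefinement⟩

end Literature.Geometry.PolyhedralFans

end
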